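import Summits.QuantumFields.YangMills.Theses.CertificationLength

/-!
# Route `CertificationLength` — the Assembly item (stmt-QuantumFields-15891)

`Assembly : CompleteAnalyticityAtLargeScales → CertifiedHypercubicLimit → DiagonalFramesAtCertificationScale → CurvatureKernelBound →
NPointIsotropyBelowThreshold → YangMills` is, verbatim and in the same order, the route's crux-only deciding theorem `CertificationLength.closes`
(the PROVED tree lemmas `curvatureChannel_proof`, `PlanarToEuclidean_proof`, … are invoked inside `closes`).  This file records the closure BY NAME.
HONEST LABEL: the five hypotheses are the route's OPEN cruxes; the summit `YangMills` is NOT proved here — this is modus ponens bookkeeping only.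

References: A. Jaffe, E. Witten, Quantum Yang–Mills theory (2000) [JaffeWitten2000]; K. Osterwalder, R. Schrader, CMP 42 (1975) [OsterwalderSchrader1975].
-/

namespace Summit.QuantumFields.YangMills.Theorems.CertificationLength

/-- **Assembly of route `CertificationLength`** (stmt-QuantumFields-15891): the route's deciding theorem, by name. -/
theorem assembly_proof : Summit.QuantumFields.YangMills.Theses.CertificationLength.Assembly :=
  fun h1 h3 hD hKB hNP => Summit.QuantumFields.YangMills.Theses.CertificationLength.closes h1 h3 hD hKB hNP

end Summit.QuantumFields.YangMills.Theorems.CertificationLength
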